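import Summits.CriticalPhenomena.PercolationContinuityZ3.Theorems.PercNearOneGluingNoHeavyPcintVdBEProcessRoot11
import Summits.CriticalPhenomena.PercolationContinuityZ3.Theorems.PercNearOneGluingNoHeavyPcintClusterExplorationRun
import Summits.CriticalPhenomena.PercolationContinuityZ3.Theorems.PercNearOneGluingNoHeavyPcintVdBEDominance
import Literature.Probability.LatticeModels.WeakBeurlingEstimate
import HarnessLib

/-!
# PCINT lane, king route, K1 step (3a): the fibres of van den Berg–Ermakov's `ξ`-process factorise

Cell `prim-pcint`, seat `prim-pcint-1` (gen 10); memo `run/shared/lean/prim/pcint/KING-ROUTE.md` §K1 (3).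

The structural ("Markov") half of K1 step (3) for the oracle `VdBEProcess11.outVdBE11` (root rule `ε(o) = (1,1)`),
run with the cluster exploration `ClusterExpl.rule` on a finite `Λ ⊆ ℤ²`.  By `AdaptDom.run_eq_iff_replay` the fibre
`{w | run_n(w) = σ}` of a state `σ` is cut out by finitely many EDGE TESTS (`Fib`): for every earlier replayed state
`τ_k` (`traj σ k`) and every site `a` examined there, `outVdBE11 w τ_k a` must equal the value recorded in `σ`; each
test reads the pair states `w a` and `w b_k` (`b_k` the selected site) through the Boolean `etaB` (= `KingPairs.EtaAdj`
on pair states, `etaAdj_cfg_iff`; = `VdBELocal.eta` of the table, `etaB_eq_eta`).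

This file: the mixing operation `AdaptDom.mixG`, the Boolean `etaB` with `etaAdj_cfg_iff` / `etaB_eq_eta`,
`ℤ²` has no triangles (`not_adj_of_adj_adj`, from `WeakBeurling.coord_step_of_adj`), the evaluation lemmas `outVdBE11_init/none/sel`, the replayed trajectory
`traj` and the fibre tests `Fib` with `run_eq_iff_fib`.  The factorisation theorem itself (step context `StepCtx`,
`fib_mixG_iff`) is in `…PcintVdBEFibreFactor.lean`.
-/

namespace Summit.CriticalPhenomena.PercolationContinuityZ3.Theorems.Pcint

/-! ### Mixing two assignments on a set of sites (general codomain) -/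

namespace AdaptDom

open Finset

variable {V : Type*} [DecidableEq V] {S : Type*}

/-- `mixG W u w`: the assignment equal to `u` on `W` and to `w` off `W`. -/
def mixG (W : Finset V) (u w : V → S) : V → S := fun v => if v ∈ W then u v else w v

/-- On `W`, `mixG` reads `u`. -/
theorem mixG_of_mem {W : Finset V} {v : V} (hv : v ∈ W) (u w : V → S) : mixG W u w v = u v := by
  simp [mixG, hv]

/-- Off `W`, `mixG` reads `w`. -/
theorem mixG_of_not_mem {W : Finset V} {v : V} (hv : v ∉ W) (u w : V → S) : mixG W u w v = w v := by
  simp [mixG, hv]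

end AdaptDom

namespace VdBEMarkov

open Finset AdaptDom ClusterExpl KingPairs VdBEProcess VdBEProcess11 VdBELocal
  Literature.Probability.Percolation Literature.Probability.LatticeModels

/-! ### `η` on pair states -/

/-- **`ℤ²` has no triangles.** -/
theorem not_adj_of_adj_adj {x y z : Site 2} (hxy : (zdGraph 2).Adj x y) (hyz : (zdGraph 2).Adj y z) :
    ¬ (zdGraph 2).Adj x z := fun hxz => by
  have h1 := WeakBeurling.coord_step_of_adj hxy
  have h2 := WeakBeurling.coord_step_of_adj hyz
  have h3 := WeakBeurling.coord_step_of_adj hxz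
  omega

/-- **`η` on pair states** (`VdBELocal.eta` written for lattice sites): the edge is oriented from the endpoint with
the smaller coordinate sum, and `η(min, max) = b b ∨ t t ∨ t_min b_max`. -/
def etaB (u v : Site 2) (su sv : PState) : Bool :=
  if u 0 + u 1 < v 0 + v 1 then etaMM su sv else etaMM sv su

/-- `etaB` is the table's `eta` at the coordinate pairs. -/
theorem etaB_eq_eta (u v : Site 2) (su sv : PState) : etaB u v su sv = eta (u 0, u 1) (v 0, v 1) su sv := rfl

/-- `etaB` is symmetric in the two (site, state) pairs when the coordinate sums differ (e.g. for neighbours). -/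
theorem etaB_comm {u v : Site 2} (h : u 0 + u 1 ≠ v 0 + v 1) (su sv : PState) : etaB u v su sv = etaB v u sv su := by
  unfold etaB
  rcases lt_or_gt_of_ne h with h1 | h1
  · rw [if_pos h1, if_neg (not_lt.2 h1.le)]
  · rw [if_neg (not_lt.2 h1.le), if_pos h1]

/-- Neighbours have coordinate sums differing by one. -/
theorem sum_ne_of_adj {x y : Site 2} (h : (zdGraph 2).Adj x y) : x 0 + x 1 ≠ y 0 + y 1 := by
  have := WeakBeurling.coord_step_of_adj h; omega

/-- `etaMM` unfolded. -/
theorem etaMM_eq_true_iff (su sv : PState) : etaMM su sv = true ↔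
    (su.1 = true ∧ sv.1 = true) ∨ (su.2 = true ∧ sv.2 = true) ∨ (su.2 = true ∧ sv.1 = true) := by
  obtain ⟨a, b⟩ := su; obtain ⟨c, d⟩ := sv
  revert a b c d; decide

variable {Λ : Finset (Site 2)}

/-- The pair state read off a configuration: `EtaAdjOr (cfg w)` is `etaMM` of the pair states. -/
theorem etaAdjOr_cfg_iff (w : ↥Λ → PState) (a b : ↥Λ) : EtaAdjOr (cfg Λ w) a.1 b.1 ↔ etaMM (w a) (w b) = true := by
  rw [etaMM_eq_true_iff]
  simp only [EtaAdjOr, pairSite_false_mem_cfg, pairSite_true_mem_cfg]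

/-- For `y = x + eᵢ` the coordinate sum goes up by one. -/
theorem sum_add_single (x : Site 2) (i : Fin 2) :
    (x + Pi.single i 1 : Site 2) 0 + (x + Pi.single i 1 : Site 2) 1 = x 0 + x 1 + 1 := by
  fin_cases i <;> simp <;> ring

/-- **`EtaAdj` on a pair-state configuration is `etaB` of the two pair states** (for lattice neighbours). -/
theorem etaAdj_cfg_iff (w : ↥Λ → PState) {a b : ↥Λ} (hab : (zdGraph 2).Adj a.1 b.1) :
    EtaAdj (cfg Λ w) a.1 b.1 ↔ etaB a.1 b.1 (w a) (w b) = true := by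
  unfold EtaAdj etaB
  rcases eq_add_single_of_adj hab with ⟨i, hi⟩ | ⟨i, hi⟩
  · have hlt : a.1 0 + a.1 1 < b.1 0 + b.1 1 := by rw [hi, sum_add_single]; omega
    have hno : ¬ ∃ j : Fin 2, a.1 = b.1 + Pi.single j 1 := by
      rintro ⟨j, hj⟩
      have := sum_add_single b.1 j
      rw [← hj] at this; omega
    rw [if_pos hlt]
    simp only [hno, false_and, or_false]
    rw [etaAdjOr_cfg_iff]
    exact ⟨fun h => h.2, fun h => ⟨⟨i, hi⟩, h⟩⟩
  · have hlt : b.1 0 + b.1 1 < a.1 0 + a.1 1 := by rw [hi, sum_add_single]; omega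
    have hno : ¬ ∃ j : Fin 2, b.1 = a.1 + Pi.single j 1 := by
      rintro ⟨j, hj⟩
      have := sum_add_single a.1 j
      rw [← hj] at this; omega
    rw [if_neg (not_lt.2 hlt.le)]
    simp only [hno, false_and, false_or]
    rw [etaAdjOr_cfg_iff]
    exact ⟨fun h => h.2, fun h => ⟨⟨i, hi⟩, h⟩⟩

/-- `decide (EtaAdj …)` as the Boolean `etaB`. -/
theorem decide_etaAdj_cfg (w : ↥Λ → PState) {a b : ↥Λ} (hab : (zdGraph 2).Adj a.1 b.1) [Decidable (EtaAdj (cfg Λ w) a.1 b.1)] :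
    decide (EtaAdj (cfg Λ w) a.1 b.1) = etaB a.1 b.1 (w a) (w b) := by
  by_cases h : EtaAdj (cfg Λ w) a.1 b.1
  · rw [decide_eq_true h, ((etaAdj_cfg_iff w hab).1 h)]
  · rw [decide_eq_false h]
    cases hb : etaB a.1 b.1 (w a) (w b)
    · rfl
    · exact absurd ((etaAdj_cfg_iff w hab).2 hb) h

/-! ### Evaluating the oracle -/

variable (enc : ↥Λ → ℕ) (o : ↥Λ)

/-- At the initial state the oracle reports `[w a = (1,1)]`. -/
theorem outVdBE11_init (w : ↥Λ → PState) {τ : ↥Λ → Option Bool} (h : ∀ v, τ v = none) (a : ↥Λ) :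
    outVdBE11 Λ enc w τ a = decide (w a = (true, true)) := by
  unfold outVdBE11; rw [if_pos h]

/-- At a non-initial state with no selected site the oracle reports `false`. -/
theorem outVdBE11_none (w : ↥Λ → PState) {τ : ↥Λ → Option Bool} (h : ¬ ∀ v, τ v = none)
    (hsel : sel (boxGraph Λ) enc τ = none) (a : ↥Λ) : outVdBE11 Λ enc w τ a = false := by
  unfold outVdBE11; rw [if_neg h, hsel]

/-- At a non-initial state with selected site `b`, on a neighbour `a` of `b` the oracle reports `η(a,b)`. -/
theorem outVdBE11_sel (w : ↥Λ → PState) {τ : ↥Λ → Option Bool} (h : ¬ ∀ v, τ v = none) {b : ↥Λ}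
    (hsel : sel (boxGraph Λ) enc τ = some b) {a : ↥Λ} (hab : (zdGraph 2).Adj a.1 b.1) :
    outVdBE11 Λ enc w τ a = etaB a.1 b.1 (w a) (w b) := by
  classical
  unfold outVdBE11; rw [if_neg h, hsel]
  exact decide_etaAdj_cfg w hab

/-! ### The replayed trajectory and the fibre tests -/

/-- The `k`-th state of the replay of `σ` (`AdaptDom.readOut`): a function of `σ` alone. -/
noncomputable def traj (σ : ↥Λ → Option Bool) (k : ℕ) : ↥Λ → Option Bool :=
  run (rule (boxGraph Λ) enc o) (readOut σ) k

/-- **The fibre tests** (a predicate of this file, not a cited fact): `w` passes iff at every replayed state before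
step `n` the oracle reports, on every examined site, the value recorded in `σ`. -/
def Fib (n : ℕ) (σ : ↥Λ → Option Bool) (w : ↥Λ → PState) : Prop :=
  ∀ k < n, ∀ a ∈ rule (boxGraph Λ) enc o (traj enc o σ k), outVdBE11 Λ enc w (traj enc o σ k) a = (σ a).getD false

/-- **Fibres of the run** (`AdaptDom.run_eq_iff_replay`): `run_n(w) = σ` iff `σ` is its own replay and `w` passes the
fibre tests. -/
theorem run_eq_iff_fib (n : ℕ) (σ : ↥Λ → Option Bool) (w : ↥Λ → PState) :
    run (rule (boxGraph Λ) enc o) (outVdBE11 Λ enc w) n = σ ↔ traj enc o σ n = σ ∧ Fib enc o n σ w :=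
  run_eq_iff_replay (rule_unrevealed (boxGraph Λ) enc o) _ n σ

/-- The root is examined at step `0` of every replay. -/
theorem root_mem_rule_zero (σ : ↥Λ → Option Bool) : o ∈ rule (boxGraph Λ) enc o (traj enc o σ 0) := by
  have h0 : ∀ v, traj enc o σ 0 v = none := fun _ => rfl
  have h : rule (boxGraph Λ) enc o (traj enc o σ 0) = {o} := by rw [rule, if_pos h0]
  rw [h]; exact mem_singleton_self o

end VdBEMarkov

end Summit.CriticalPhenomena.PercolationContinuityZ3.Theorems.Pcint
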